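import Literature.AnabelianGeometry.EtaleTheta.Discharge.Sec5TransportAtBNOfBiKummerData
import HarnessLib

/-!
# [EtTh] Thm. 5.6 (cyclotomic rigidity is preserved by self-equivalences) at the assembled §5 data (abc-iut L2, K4 line, row T56-A)

PROOF-ONLY.  abc-iut-w5-d020's abstract assembly `Thm56Sub.cyclotomicRigidityPreserved_of_sub` (p417981 = abc-iut-L2-d4's
`cyclotomicRigidityPreserved_of` ∘ T56-L09 `transportAtBN_of`) instantiated at abc-iut-L2-t4's `ThetaFrobenioid.ofBiKummerData`,
with the same inputs discharged by name as in `transportAtBN_ofBiKummerData` (total epimorphicity, the section relations,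
units-centrality T56-L09b, `UnitsPullSpec`, `DeltaTransportCompat` T56-L09c of abc-iut-w5-d013, coverage of abc-iut-w5-d123).
NAMED binders (no new `Prop` constants): the base shadow `Ψbs`/`eΨ` of `Ψ` and its linearity / `aΨ`-naturality / μ-pull
transport (`hlin`, `haΨn`, `hpull` — abc-iut-L2-d4's transport hypotheses, [EtTh] Thm 5.6 proof p.329 second half),
t4's transport step `hreach`, `hdiff`, `hT`/`hT'`/`hu`/`hstrv`/`hYdd` (abc-iut-L2-t9 MERGE-PLAN row 2), the rigidity family
`ρ` with `hK`/`hρ` (Prop. 5.5: `cyclotomicRigidity_ofBiKummerData_of_laws`), the printed relations `hγ`/`hγL`/`haΨ` and the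
row-2 laws.  No side taken on [IUTchIII] Cor. 3.12; typed ≠ proved for the named binders.
[cite: MochizukiEtTh2009, Thm 5.6 p.328–329 (PDF pp.102–103)]
-/

noncomputable section

namespace Literature.AnabelianGeometry.EtaleTheta

open CategoryTheory Opposite FrobenioidCyclotomicRigidity Literature.AlgebraicGeometry.Frobenioids

universe u₀ v₀ u v w

namespace ThetaFrobenioid

variable {K : Type u₀} [Field K]
  {X : SemiGraphs.TemperedArithmeticGroup.{u₀} K} {D₀ : Type u₀} [Category.{v₀} D₀]
  {V : FrdIMonoidStub.{w}} {T₀ : RealifiedDivisorMonoids (D₀ := D₀) V} {D : Type u} [Category.{v} D]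
  {VD : FrdICatStub.{u, v, w} D} {S : BiKummerSetting X T₀ D VD}
  {pullFrac : ∀ {A A' : S.C} (_ : A' ⟶ A), S.biratUnits A → S.biratUnits A'}
  {lv N : ℕ+} {l' : ℕ} {RD : RigidData.{max v w} N l'} {θ : S.biratUnits S.Aodot} {Bl : S.C}
  {Pl : S.FractionPair θ Bl} {Rl : S.NthRoot θ Pl lv pullFrac}
  (h : ModelFrobenioid.Hypotheses S.tf.divisorMonoid S.tf.ratFnFunctor)
  (toB : ∀ A : S.C, S.biratUnits A →* S.tf.biratUnitsModel A) (Q : FrobenioidTheta.ThetaSubquotientStub.{w} D)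
  (odd_l : Odd (lv : ℕ)) (R : S.NthRoot Rl.root Rl.pair N pullFrac) (ιX : RD.PiX ≃ₜ* X.Pi)
  (hopen : IsOpen ((S.galoisSurj R.AN.base R.αData.isGalois).ker : Set X.Pi)) (σ : Aut R.AN.base →* Aut R.AN)
  (K' : Type w) [Field K'] (constEmb : K'ˣ →* S.tf.biratUnitsModel R.BN)
  (constEmb_injective : Function.Injective constEmb)
  (hdivc : ∀ g : Aut R.BN.base,
    ModelFrobenioid.div ((σ ((BiKummerSetting.NthRoot.baseIso S R).conjAut.symm g)).hom ≫ R.pair.num) =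
      ModelFrobenioid.div R.pair.num)
  (hdivp : ∀ y : RD.PiYdd,
    ModelFrobenioid.div ((σ (S.galoisSurj R.AN.base R.αData.isGalois (ιX y.1))).hom ≫ R.pair.den) =
      ModelFrobenioid.div R.pair.den)

/-- **[EtTh] Theorem 5.6 at the assembled §5 data** — abc-iut-L2-t4's `CyclotomicRigidityPreserved (ofBiKummerData …) Ψ ρ aΨ`:
a self-equivalence `Ψ` of the tempered Frobenioid (with base shadow `Ψbs`, transported to `A_N`, `B_N` compatibly with
the sections and the theta structure, linear, natural for `aΨ` and the μ-pulls) PRESERVES the rigidity family `ρ` of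
Prop. 5.5 — from `Thm56Sub.cyclotomicRigidityPreserved_of_sub` with total epimorphicity, the section relations,
units-centrality (T56-L09b), `UnitsPullSpec`, `DeltaTransportCompat` (T56-L09c) and coverage discharged by name.
[cite: MochizukiEtTh2009, Thm 5.6 p.328–329 (PDF pp.102–103)] -/
theorem cyclotomicRigidityPreserved_ofBiKummerData
    (Ψ : S.C ≌ S.C) (Ψbs : D ⥤ D) [Ψbs.Faithful] (eΨ : Ψ.functor ⋙ (ofBiKummerData h toB Q odd_l R ιX hopen σ K' constEmb constEmb_injective hdivc hdivp).base ≅ (ofBiKummerData h toB Q odd_l R ιX hopen σ K' constEmb constEmb_injective hdivc hdivp).base ⋙ Ψbs)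
    (α : Ψ.functor.obj (ofBiKummerData h toB Q odd_l R ιX hopen σ K' constEmb constEmb_injective hdivc hdivp).AN ≅ (ofBiKummerData h toB Q odd_l R ιX hopen σ K' constEmb constEmb_injective hdivc hdivp).AN)
    (β : Ψ.functor.obj (ofBiKummerData h toB Q odd_l R ιX hopen σ K' constEmb constEmb_injective hdivc hdivp).BN ≅ (ofBiKummerData h toB Q odd_l R ιX hopen σ K' constEmb constEmb_injective hdivc hdivp).BN)
    (eA : (ofBiKummerData h toB Q odd_l R ιX hopen σ K' constEmb constEmb_injective hdivc hdivp).AN ≅ (ofBiKummerData h toB Q odd_l R ιX hopen σ K' constEmb constEmb_injective hdivc hdivp).AN) (Dp : Aut (ofBiKummerData h toB Q odd_l R ιX hopen σ K' constEmb constEmb_injective hdivc hdivp).BN)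
    (θΨ : Aut R.BN.base ≃* Aut R.BN.base)
    (aΨ : ∀ A : S.C, (ofBiKummerData h toB Q odd_l R ιX hopen σ K' constEmb constEmb_injective hdivc hdivp).lDeltaModN A ≃* (ofBiKummerData h toB Q odd_l R ιX hopen σ K' constEmb constEmb_injective hdivc hdivp).lDeltaModN (Ψ.functor.obj A))
    -- abc-iut-L2-d4's transport hypotheses on Ψ
    (hlin : PreFrobenioidData.PreservesMor Ψ.functor (ofBiKummerData h toB Q odd_l R ιX hopen σ K' constEmb constEmb_injective hdivc hdivp).IsLinear (ofBiKummerData h toB Q odd_l R ιX hopen σ K' constEmb constEmb_injective hdivc hdivp).IsLinear)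
    (haΨn : ∀ {A A' : S.C} (φ : A ⟶ A') (x : (ofBiKummerData h toB Q odd_l R ιX hopen σ K' constEmb constEmb_injective hdivc hdivp).lDeltaModN A),
      aΨ A' ((ofBiKummerData h toB Q odd_l R ιX hopen σ K' constEmb constEmb_injective hdivc hdivp).lDeltaModNMap φ x) = (ofBiKummerData h toB Q odd_l R ιX hopen σ K' constEmb constEmb_injective hdivc hdivp).lDeltaModNMap (Ψ.functor.map φ) (aΨ A x))
    (hpull : ∀ {A A' : S.C} (φ : A ⟶ A') (u : (ofBiKummerData h toB Q odd_l R ιX hopen σ K' constEmb constEmb_injective hdivc hdivp).muTorsion A' (ofBiKummerData h toB Q odd_l R ιX hopen σ K' constEmb constEmb_injective hdivc hdivp).N)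
      (hu : Ψ.functor.mapAut A' (u : Aut A') ∈ (ofBiKummerData h toB Q odd_l R ιX hopen σ K' constEmb constEmb_injective hdivc hdivp).muTorsion (Ψ.functor.obj A') (ofBiKummerData h toB Q odd_l R ιX hopen σ K' constEmb constEmb_injective hdivc hdivp).N),
      Ψ.functor.mapAut A ((ofBiKummerData h toB Q odd_l R ιX hopen σ K' constEmb constEmb_injective hdivc hdivp).muTorsionPull φ (ofBiKummerData h toB Q odd_l R ιX hopen σ K' constEmb constEmb_injective hdivc hdivp).N u : Aut A) =
        ((ofBiKummerData h toB Q odd_l R ιX hopen σ K' constEmb constEmb_injective hdivc hdivp).muTorsionPull (Ψ.functor.map φ) (ofBiKummerData h toB Q odd_l R ιX hopen σ K' constEmb constEmb_injective hdivc hdivp).N ⟨_, hu⟩ : Aut (Ψ.functor.obj A)))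
    (hreach : LinearlyReachableFromBN (ofBiKummerData h toB Q odd_l R ιX hopen σ K' constEmb constEmb_injective hdivc hdivp))
    (hdiff : (ofBiKummerData h toB Q odd_l R ιX hopen σ K' constEmb constEmb_injective hdivc hdivp).BiKummerDifferenceMem)
    (hT : α.inv ≫ Ψ.functor.map (ofBiKummerData h toB Q odd_l R ιX hopen σ K' constEmb constEmb_injective hdivc hdivp).sCap ≫ β.hom =
      eA.hom ≫ (ofBiKummerData h toB Q odd_l R ιX hopen σ K' constEmb constEmb_injective hdivc hdivp).sCap ≫ (1 : Aut (ofBiKummerData h toB Q odd_l R ιX hopen σ K' constEmb constEmb_injective hdivc hdivp).BN).hom)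
    (hT' : α.inv ≫ Ψ.functor.map (ofBiKummerData h toB Q odd_l R ιX hopen σ K' constEmb constEmb_injective hdivc hdivp).sCup ≫ β.hom =
      eA.hom ≫ (ofBiKummerData h toB Q odd_l R ιX hopen σ K' constEmb constEmb_injective hdivc hdivp).sCup ≫ Dp.hom)
    (hu : Dp ∈ (ofBiKummerData h toB Q odd_l R ιX hopen σ K' constEmb constEmb_injective hdivc hdivp).units (ofBiKummerData h toB Q odd_l R ιX hopen σ K' constEmb constEmb_injective hdivc hdivp).BN)
    (hstrv : (ofBiKummerData h toB Q odd_l R ιX hopen σ K' constEmb constEmb_injective hdivc hdivp).StrvTransport Ψ α eA θΨ)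
    (hYdd : (ofBiKummerData h toB Q odd_l R ιX hopen σ K' constEmb constEmb_injective hdivc hdivp).HB.map θΨ.toMonoidHom = (ofBiKummerData h toB Q odd_l R ιX hopen σ K' constEmb constEmb_injective hdivc hdivp).HB)
    (P : ThetaSubquotientProj (ofBiKummerData h toB Q odd_l R ιX hopen σ K' constEmb constEmb_injective hdivc hdivp))
    (hσ : ∀ g : Aut R.AN.base, ModelFrobenioid.baseMap (σ g).hom = g.hom)
    (hgeom : P.pre R.BN.base ≤ RD.aug.ker.map (rhoOfBiKummerData R ιX))
    (hconst : ∀ δ ∈ RD.aug.ker, ∀ τ : ModelFrobenioid.units R.BN,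
      (S.tf.ratFnFunctor.map (rhoOfBiKummerData R ιX δ).hom.op).hom (ModelFrobenioid.unit τ.1.hom) =
        ModelFrobenioid.unit τ.1.hom)
    (e : RD.mu → (ofBiKummerData h toB Q odd_l R ιX hopen σ K' constEmb constEmb_injective hdivc hdivp).lDeltaModN (ofBiKummerData h toB Q odd_l R ιX hopen σ K' constEmb constEmb_injective hdivc hdivp).BN)
    (he : Function.Surjective e)
    (hpre : ∀ k : RD.PiYdd, (k : RD.PiX) ∈ RD.lDeltaTheta → rhoOfBiKummerData R ιX k ∈ P.pre _)
    (hP : ∀ (k : RD.PiYdd) (hk : (k : RD.PiX) ∈ RD.lDeltaTheta) (hm : rhoOfBiKummerData R ιX k ∈ P.pre _),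
      (QuotientGroup.mk (P.proj _ ⟨rhoOfBiKummerData R ιX k, hm⟩) : (ofBiKummerData h toB Q odd_l R ιX hopen σ K' constEmb constEmb_injective hdivc hdivp).lDeltaModN (ofBiKummerData h toB Q odd_l R ιX hopen σ K' constEmb constEmb_injective hdivc hdivp).BN) = e (RD.thetaMod ⟨k, hk⟩))
    (hcov' : ∀ g ∈ P.pre ((ofBiKummerData h toB Q odd_l R ιX hopen σ K' constEmb constEmb_injective hdivc hdivp).base.obj (ofBiKummerData h toB Q odd_l R ιX hopen σ K' constEmb constEmb_injective hdivc hdivp).BN),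
      ∃ k : RD.PiYdd, (k : RD.PiX) ∈ RD.lDeltaTheta ∧ rhoOfBiKummerData R ιX k = g)
    (γ : RD.PiX ≃ₜ* RD.PiX)
    (hγ : ∀ y : RD.PiX, θΨ (rhoOfBiKummerData R ιX y) = rhoOfBiKummerData R ιX (γ y))
    (hγL : RD.lDeltaTheta.map γ.toMulEquiv.toMonoidHom = RD.lDeltaTheta)
    (haΨ : ∀ (k : RD.PiYdd) (hk : (k : RD.PiX) ∈ RD.lDeltaTheta) (hk' : γ k ∈ RD.lDeltaTheta),
      (ofBiKummerData h toB Q odd_l R ιX hopen σ K' constEmb constEmb_injective hdivc hdivp).lDeltaModNMap β.hom (aΨ _ (e (RD.thetaMod ⟨k, hk⟩))) = e (RD.thetaMod ⟨γ k, hk'⟩))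
    (ρ : RigidityFamily (ofBiKummerData h toB Q odd_l R ιX hopen σ K' constEmb constEmb_injective hdivc hdivp))
    (hB : (ofBiKummerData h toB Q odd_l R ιX hopen σ K' constEmb constEmb_injective hdivc hdivp).IsThetaSaturated (ofBiKummerData h toB Q odd_l R ιX hopen σ K' constEmb constEmb_injective hdivc hdivp).BN)
    (hK : IsKummerDetermined (ofBiKummerData h toB Q odd_l R ιX hopen σ K' constEmb constEmb_injective hdivc hdivp) P ρ hB) (hρ : IsFunctorialLinear (ofBiKummerData h toB Q odd_l R ιX hopen σ K' constEmb constEmb_injective hdivc hdivp) ρ) :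
    CyclotomicRigidityPreserved (ofBiKummerData h toB Q odd_l R ιX hopen σ K' constEmb constEmb_injective hdivc hdivp) Ψ ρ aΨ := by
  haveI : Epi (ofBiKummerData h toB Q odd_l R ιX hopen σ K' constEmb constEmb_injective hdivc hdivp).sCap := epi_of_model (DivB := S.tf.divBNatTrans) h _
  haveI : Epi (ofBiKummerData h toB Q odd_l R ιX hopen σ K' constEmb constEmb_injective hdivc hdivp).sCup := epi_of_model (DivB := S.tf.divBNatTrans) h _
  exact Thm56Sub.cyclotomicRigidityPreserved_of_sub Ψ α β eA Dp θΨ Ψbs eΨ aΨ ρ hB hreach hρ hlin haΨn hpull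
    (sgpCapSpec_ofBiKummerData h toB Q odd_l R ιX hopen σ K' constEmb constEmb_injective hdivc hdivp)
    (sgpCupSpec_ofBiKummerData h toB Q odd_l R ιX hopen σ K' constEmb constEmb_injective hdivc hdivp)
    hdiff hT hT' hu hstrv hYdd P
    (unitsCentralUnderLDelta_ofBiKummerData h toB Q odd_l R ιX hopen σ K' constEmb constEmb_injective hdivc hdivp
      hσ P hgeom hconst)
    (unitsPullSpec_ofBiKummerData h toB Q odd_l R ιX hopen σ K' constEmb constEmb_injective hdivc hdivp)
    (Thm56Sub.deltaTransportCompat_ofBiKummerData h toB Q odd_l R ιX hopen σ K' constEmb constEmb_injective hdivc hdivp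
      e P hpre hP hcov' Ψ β aΨ θΨ γ hγ hγL haΨ)
    hK
    (lDeltaCovered_ofBiKummerData h toB Q odd_l R ιX hopen σ K' constEmb constEmb_injective hdivc hdivp e he P hpre hP)

end ThetaFrobenioid

end Literature.AnabelianGeometry.EtaleTheta
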